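import Literature.NumberTheory.EllipticCurves.NeronComponentIndexTypeIVstarPoints
import Literature.NumberTheory.EllipticCurves.LocalIndexThreeClasses
import Literature.NumberTheory.DiophantineGeometry.TateAlgorithmTranslationsProofs
import HarnessLib

/-!
# The local index for type `IV*`: `c_v ∈ {1, 3}` (proof)

Discharge of the named fact
`Literature.NumberTheory.EllipticCurves.localTamagawaNumber_of_kodairaSymbolAt_eq_IVstar`
(`NeronComponentIndex.lean`; Silverman, *ATAEC*, IV.9.4 Step 8, PDF p. 346: "Type IV*, `m = 7`,
`f = v(Δ) − 6`, `c = 3` if `k' = k`, `c = 1` if `k' ≠ k`", `k'` the splitting field of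
`Y² + a₃,₂Y − a₆,₄`), in the recorded form `c_v = 1 ∨ c_v = 3` — the argument of
`NeronComponentIndexTypeIVProofs.lean` two levels deeper, with the coordinate computations of
`NeronComponentIndexTypeIVstarPoints.lean`; no Néron model and no Hensel lifting.

## Proof

Over a discrete valuation ring `R` with perfect residue field, if Tate's algorithm returns `IV*`
then after the translations of Steps 2, 6, 8 (`TateAlgorithmTranslationsProofs`) the model
`J = D • I` has `π ∣ a₁`, `π² ∣ a₂, a₃`, `π³ ∣ a₄`, `π⁴ ∣ a₆` and the quadratic `Y² + γ̄Y − ε̄`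
(`a₃ = π²γ`, `a₆ = π⁴ε`) has distinct roots (`exists_smul_of_kodairaSymbolOfMinimal_eq_IVstar`).
Bad points are `(π²x₂, π²y₂)` with label `ȳ₂ ∈ {r₁, r₂}`; negation and same-label sums behave as
for type `IV`, so `LocalIndex.index_eq_three_of_cls` gives index `3` if a bad point exists, and the
index is `1` otherwise; it is the same for `I`, and this is `c_v` at a place `v`.

## References

* J. H. Silverman, *Advanced Topics in the Arithmetic of Elliptic Curves*, GTM 151, Springer
  1994, IV.9.4 Step 8 (PDF p. 346) and its proof (PDF pp. 352–353; Table 4.1: `Φ = ℤ/3ℤ`).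
  [SilvermanATAEC1994]
-/

noncomputable section

open scoped Classical

open IsLocalRing Polynomial

namespace Literature.NumberTheory.EllipticCurves

namespace LocalIndex

open DiophantineGeometry DiophantineGeometry.TateAlgorithm

variable {R : Type*} [CommRing R] [IsDomain R] [IsDiscreteValuationRing R]

/-! ### Step 8 fired: the normal form -/

/-- Tate's tree returns `IV*` exactly when the first seven tests fail and the eighth fires.
[folklore] -/
theorem tateTree_eq_IVstar_iff (p1 p2 p3 p4 p5 p6 p7 p8 p9 p10 : Prop) [Decidable p1]
    [Decidable p2] [Decidable p3] [Decidable p4] [Decidable p5] [Decidable p6] [Decidable p7]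
    [Decidable p8] [Decidable p9] [Decidable p10] (n m : ℕ) :
    (if p1 then KodairaSymbol.I 0 else if p2 then .I n else if p3 then .II else if p4 then .III
      else if p5 then .IV else if p6 then .Istar 0 else if p7 then .Istar m
      else if p8 then .IVstar else if p9 then .IIIstar else if p10 then .IIstar else .I 0) =
        .IVstar ↔ ¬ p1 ∧ ¬ p2 ∧ ¬ p3 ∧ ¬ p4 ∧ ¬ p5 ∧ ¬ p6 ∧ ¬ p7 ∧ p8 := by
  split_ifs <;> simp [*]

/-- **The normal form of type `IV*`.** Over a perfect residue field, if Tate's algorithm returns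
`IV*` then some `R`-model `D • V` has `π ∣ a₁`, `π² ∣ a₂`, `π² ∣ a₃`, `π³ ∣ a₄`, `π⁴ ∣ a₆` and its
Step-8 quadratic has two distinct roots in `k̄` (the translations of Steps 2, 6, 8 exist;
Silverman, *ATAEC*, IV.9.4 Steps 6–8, PDF pp. 344–346). [cite: SilvermanATAEC1994, IV.9.4 Step 8] -/
theorem exists_smul_of_kodairaSymbolOfMinimal_eq_IVstar [PerfectField (ResidueField R)]
    (V : WeierstrassCurve R) (hV : V.kodairaSymbolOfMinimal = .IVstar) :
    ∃ D : WeierstrassCurve.VariableChange R,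
      (D • V).a₁ ∈ maximalIdeal R ∧ (D • V).a₂ ∈ maximalIdeal R ^ 2 ∧
      (D • V).a₃ ∈ maximalIdeal R ^ 2 ∧ (D • V).a₄ ∈ maximalIdeal R ^ 3 ∧
      (D • V).a₆ ∈ maximalIdeal R ^ 4 ∧ distinctRootCount (quadraticStep8 (D • V)) = 2 := by
  unfold WeierstrassCurve.kodairaSymbolOfMinimal at hV
  obtain ⟨h1, h2, h3, h4, h5, h6t, h7t, h8t⟩ :=
    (tateTree_eq_IVstar_iff _ _ _ _ _ _ _ _ _ _ _ _).mp hV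
  rw [not_not] at h1 h2 h3 h4 h5
  -- Step 2
  have hex2 := exists_variableChange_step2_of_perfectField V h1
  have hN2 : normalizeStep2 V = hex2.choose • V := dif_pos hex2
  obtain ⟨-, hA₃, hA₄, -⟩ := hex2.choose_spec
  rw [hN2] at h2 h3 h4 h5 h6t h7t h8t
  -- Step 6
  have hex6 := exists_variableChange_step6_of_perfectField h2 hA₃ hA₄ h3 h5 h4
  have hN6 : normalizeStep6 (hex2.choose • V) = hex6.choose • (hex2.choose • V) := dif_pos hex6
  obtain ⟨-, hB₁, hB₂, hB₃, hB₄, hB₆⟩ := hex6.choose_spec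
  rw [hN6] at h6t h7t h8t
  -- Step 8
  have hex8 := exists_variableChange_step8_of_perfectField hB₁ hB₂ hB₃ hB₄ hB₆ h6t h7t
  have hN8 : normalizeStep8 (hex6.choose • (hex2.choose • V)) =
      hex8.choose • (hex6.choose • (hex2.choose • V)) := dif_pos hex8
  obtain ⟨-, hD₁, hD₂, hD₃, hD₄, hD₆⟩ := hex8.choose_spec
  rw [hN8] at h8t
  refine ⟨hex8.choose * hex6.choose * hex2.choose, ?_⟩
  simp only [mul_smul]
  exact ⟨hD₁, hD₂, hD₃, hD₄, hD₆, h8t⟩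

variable {K : Type*} [Field K] [Algebra R K] [IsFractionRing R K]

/-! ### The index for the normal form -/

/-- **`[E(K) : E₀(K)] ∈ {1, 3}` for the normal form of type `IV*`** (`π ∣ a₁`, `π² ∣ a₂, a₃`,
`π³ ∣ a₄`, `π⁴ ∣ a₆`, Step-8 quadratic with distinct roots): if some point has singular reduction,
label the bad points by the root `ȳ₂ ∈ {r₁, r₂}` and apply `LocalIndex.index_eq_three_of_cls`;
otherwise the index is `1`. [cite: SilvermanATAEC1994, IV.9.4 Step 8] -/
theorem index_mem_of_normalForm_IVstar (J : WeierstrassCurve R) (h1 : J.a₁ ∈ maximalIdeal R)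
    (h2 : J.a₂ ∈ maximalIdeal R ^ 2) (h3 : J.a₃ ∈ maximalIdeal R ^ 2)
    (h4 : J.a₄ ∈ maximalIdeal R ^ 3) (h6 : J.a₆ ∈ maximalIdeal R ^ 4)
    (h8 : distinctRootCount (quadraticStep8 J) = 2) :
    (J.nonsingularReductionSubgroup (integers_valuationRing_valuation R K)).index = 1 ∨
      (J.nonsingularReductionSubgroup (integers_valuationRing_valuation R K)).index = 3 := by
  have hϖ : Irreducible (uniformizer R) := irreducible_uniformizer
  set ϖ := uniformizer R with hϖdef
  set H := J.nonsingularReductionSubgroup (integers_valuationRing_valuation R K) with hH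
  have hm : ϖ ∈ maximalIdeal R := (IsLocalRing.mem_maximalIdeal _).mpr hϖ.not_isUnit
  have hm2 : ϖ ^ 2 ∈ maximalIdeal R := Ideal.pow_mem_of_mem _ hm 2 two_pos
  have hres0 : residue R ϖ = 0 := (residue_eq_zero_iff _).mpr hm
  obtain ⟨α, hα⟩ := mem_maximalIdeal_iff_dvd.mp h1
  obtain ⟨β, hβ⟩ := mem_maximalIdeal_pow_iff_dvd.mp h2
  obtain ⟨γ, hγ⟩ := mem_maximalIdeal_pow_iff_dvd.mp h3
  obtain ⟨δ, hδ⟩ := mem_maximalIdeal_pow_iff_dvd.mp h4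
  obtain ⟨ε, hε⟩ := mem_maximalIdeal_pow_iff_dvd.mp h6
  have hdisc : residue R γ ^ 2 + 4 * residue R ε ≠ 0 := by
    rw [quadraticStep8_eq hγ hε] at h8
    unfold distinctRootCount at h8
    refine (card_aroots_toFinset_sq_add_sub_eq_two_iff_ne_zero
      (L := AlgebraicClosure (ResidueField R)) (residue R γ) (residue R ε)).mp ?_
    convert h8
  have h3' : J.a₃ ∈ maximalIdeal R := Ideal.pow_le_self two_ne_zero h3
  have h4' : J.a₄ ∈ maximalIdeal R := Ideal.pow_le_self three_ne_zero h4
  have h6' : J.a₆ ∈ maximalIdeal R := Ideal.pow_le_self (by norm_num) h6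
  -- no bad point: index one
  by_cases hex : ∃ P : (J.baseChange K).toAffine.Point, ¬ J.HasNonsingularReduction P
  swap
  · left
    rw [AddSubgroup.index_eq_one, eq_top_iff]
    exact fun P _ => (WeierstrassCurve.mem_nonsingularReductionSubgroup_iff _).mpr
      (not_not.mp fun h => hex ⟨P, h⟩)
  right
  obtain ⟨P₀, hP₀⟩ := hex
  -- coordinates of bad points and the label
  have hbad : ∀ P : (J.baseChange K).toAffine.Point, ¬ J.HasNonsingularReduction P →
      ∃ (x₁ y₁ : R) (h : (J.baseChange K).toAffine.Nonsingular (algebraMap R K (ϖ ^ 2 * x₁))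
        (algebraMap R K (ϖ ^ 2 * y₁))), P = .some _ _ h ∧
          residue R y₁ ^ 2 + residue R γ * residue R y₁ - residue R ε = 0 := by
    intro P hP
    obtain ⟨x₁, y₁, h, rfl, hid⟩ :=
      exists_eq_some_of_not_hasNonsingularReduction_IVstar J hϖ hα hβ hγ hδ hε hP
    refine ⟨x₁, y₁, h, rfl, ?_⟩
    have := congrArg (residue R) hid
    simpa [hres0] using this
  choose! fx fy fh hPeq hfroot using hbad
  set r₁ := residue R (fy P₀) with hr₁def
  have hr₁ := hfroot P₀ hP₀
  -- `fy` is determined by the point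
  have hfy : ∀ (x₁ y₁ : R) (h : (J.baseChange K).toAffine.Nonsingular (algebraMap R K (ϖ ^ 2 * x₁))
      (algebraMap R K (ϖ ^ 2 * y₁))), ¬ J.HasNonsingularReduction (.some _ _ h) →
        fy (.some _ _ h) = y₁ := by
    intro x₁ y₁ h hP
    have e := hPeq _ hP
    simp only [WeierstrassCurve.Affine.Point.some.injEq] at e
    exact (mul_left_cancel₀ (pow_ne_zero 2 hϖ.ne_zero) (IsFractionRing.injective R K e.2)).symm
  have hroot : ∀ P, ¬ J.HasNonsingularReduction P →
      residue R (fy P) = r₁ ∨ residue R (fy P) = -r₁ - residue R γ :=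
    fun P hP => root_quadratic_eq_or (hfroot P hP) hr₁
  have hsimple : ∀ P, ¬ J.HasNonsingularReduction P →
      2 * residue R (fy P) + residue R γ ≠ 0 :=
    fun P hP => two_mul_add_ne_zero_of_root (hfroot P hP) hdisc
  have hr₁₂ : -r₁ - residue R γ ≠ r₁ := by
    intro h
    apply two_mul_add_ne_zero_of_root hr₁ hdisc
    linear_combination -h
  -- the label and its flip
  set cls : (J.baseChange K).toAffine.Point → Bool := fun P => decide (residue R (fy P) = r₁)
    with hcls
  have hflip : ∀ ρ : ResidueField R, (ρ = r₁ ∨ ρ = -r₁ - residue R γ) →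
      decide (-ρ - residue R γ = r₁) = !decide (ρ = r₁) := by
    rintro ρ (rfl | rfl)
    · simp [hr₁₂]
    · have e : -(-r₁ - residue R γ) - residue R γ = r₁ := by ring
      rw [e]
      simp [hr₁₂]
  have hbadpt : ∀ (x₁ y₁ : R) (h : (J.baseChange K).toAffine.Nonsingular
      (algebraMap R K (ϖ ^ 2 * x₁)) (algebraMap R K (ϖ ^ 2 * y₁))),
      ¬ J.HasNonsingularReduction (.some _ _ h) := by
    intro x₁ y₁ h
    exact not_hasNonsingularReduction_some J h3' h4' (Ideal.mul_mem_right _ _ hm2)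
      (Ideal.mul_mem_right _ _ hm2) h
  -- negation swaps the label
  have hneg : ∀ P, P ∉ H → -P ∉ H ∧ cls (-P) = !cls P := by
    intro P hP
    rw [hH, WeierstrassCurve.mem_nonsingularReductionSubgroup_iff] at hP
    have hPy := hfy _ _ (fh P hP) (hPeq P hP ▸ hP)
    obtain ⟨h', e⟩ := neg_eq_some_IVstar J hα hγ (fh P hP)
    have hnegbad := hbadpt _ _ h'
    have hy' := hfy _ _ h' hnegbad
    rw [hPeq P hP, e, hH, WeierstrassCurve.mem_nonsingularReductionSubgroup_iff]
    refine ⟨hnegbad, ?_⟩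
    simp only [hcls]
    rw [hy', hPy]
    simp only [map_sub, map_neg, map_mul]
    rw [← hϖdef, hres0, zero_mul, zero_mul, sub_zero]
    exact hflip _ (hroot P hP)
  -- same label: the sum is bad with the other label
  have hsame : ∀ P Q, P ∉ H → Q ∉ H → cls P = cls Q → P + Q ∉ H ∧ cls (P + Q) = !cls P := by
    intro P Q hP hQ hPQ
    rw [hH, WeierstrassCurve.mem_nonsingularReductionSubgroup_iff] at hP hQ
    have hPy := hfy _ _ (fh P hP) (hPeq P hP ▸ hP)
    have hres : residue R (fy P) = residue R (fy Q) := by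
      simp only [hcls, decide_eq_decide] at hPQ
      rcases hroot P hP with h | h <;> rcases hroot Q hQ with h' | h'
      · rw [h, h']
      · exact absurd (hPQ.mp h) (h' ▸ hr₁₂)
      · exact absurd (hPQ.mpr h') (h ▸ hr₁₂)
      · rw [h, h']
    obtain ⟨X, Y, h₃, hsum, hY⟩ := add_eq_some_IVstar J hϖ hα hβ hγ hδ hres (hsimple P hP)
      (fh P hP) (fh Q hQ)
    have hsumbad := hbadpt _ _ h₃
    have hyY := hfy _ _ h₃ hsumbad
    rw [hPeq P hP, hPeq Q hQ, hsum, hH, WeierstrassCurve.mem_nonsingularReductionSubgroup_iff]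
    refine ⟨hsumbad, ?_⟩
    simp only [hcls]
    rw [hyY, hPy, hY]
    exact hflip _ (hroot P hP)
  exact index_eq_three_of_cls H cls hneg hsame
    (x₀ := P₀) (by rwa [hH, WeierstrassCurve.mem_nonsingularReductionSubgroup_iff])


/-- **`[E(K) : E₀(K)] ∈ {1, 3}` for type `IV*`** over a discrete valuation ring with perfect
residue field (Silverman, *ATAEC*, IV.9.4 Step 8: `c = 3` or `1`).
[cite: SilvermanATAEC1994, IV.9.4 Step 8] -/
theorem index_mem_of_kodairaSymbolOfMinimal_eq_IVstar [PerfectField (ResidueField R)]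
    (I : WeierstrassCurve R) (hI : I.kodairaSymbolOfMinimal = .IVstar) :
    (I.nonsingularReductionSubgroup (integers_valuationRing_valuation R K)).index = 1 ∨
      (I.nonsingularReductionSubgroup (integers_valuationRing_valuation R K)).index = 3 := by
  obtain ⟨D, h1, h2, h3, h4, h6, h8⟩ := exists_smul_of_kodairaSymbolOfMinimal_eq_IVstar I hI
  rw [← index_nonsingularReductionSubgroup_smul I D]
  exact index_mem_of_normalForm_IVstar (D • I) h1 h2 h3 h4 h6 h8

end LocalIndex

/-! ### The discharge -/

section Discharge

open IsDedekindDomain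

variable {A : Type*} [CommRing A] [IsDedekindDomain A] {K : Type*} [Field K] [Algebra A K]
  [IsFractionRing A K] (v : HeightOneSpectrum A) (W : WeierstrassCurve K)

/-- **Discharge of `localTamagawaNumber_of_kodairaSymbolAt_eq_IVstar`**: `c_v ∈ {1, 3}` for
type `IV*` (Silverman, *ATAEC*, IV.9.4 Step 8, PDF p. 346), by the elementary argument of this
file. [cite: SilvermanATAEC1994, IV.9.4 Step 8 (PDF p. 346)] -/
theorem localTamagawaNumber_of_kodairaSymbolAt_eq_IVstar_holds :
    localTamagawaNumber_of_kodairaSymbolAt_eq_IVstar v W := by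
  intro _ _ hk
  rw [WeierstrassCurve.kodairaSymbolAt_def] at hk
  change ((W.localMinimalModel v).goodReductionSubgroup (v.adicCompletionIntegers K)).index = 1 ∨
    ((W.localMinimalModel v).goodReductionSubgroup (v.adicCompletionIntegers K)).index = 3
  have key : ∀ (M : WeierstrassCurve (v.adicCompletion K))
      [M.IsMinimal (v.adicCompletionIntegers K)],
      (M.integralModel (v.adicCompletionIntegers K)).kodairaSymbolOfMinimal = .IVstar →
        (M.goodReductionSubgroup (v.adicCompletionIntegers K)).index = 1 ∨
        (M.goodReductionSubgroup (v.adicCompletionIntegers K)).index = 3 := by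
    intro M _ hM
    obtain ⟨I, rfl⟩ : ∃ I : WeierstrassCurve (v.adicCompletionIntegers K),
        M = I.baseChange (v.adicCompletion K) := WeierstrassCurve.IsIntegral.integral
    rw [WeierstrassCurve.integralModel_baseChange_eq] at hM
    rw [WeierstrassCurve.goodReductionSubgroup_baseChange_eq]
    exact LocalIndex.index_mem_of_kodairaSymbolOfMinimal_eq_IVstar I hM
  exact key (W.localMinimalModel v) hk

end Discharge

end Literature.NumberTheory.EllipticCurves

end
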